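import Mathlib
import Literature.Analysis.FluidPDE.Tao2016AveragedNS.ShiftSetCascadeFlows
import Summits.NavierStokesRegularity.NavierStokesRegularity.Theorems.TaoLadderRungTwoFlatCertificateGlueCheckerFieldOn
import HarnessLib

/-!
# Certificate glue on a shift set `𝕊`, XXV-e: THE CHECKER'S (B)-TABLE TEST — the per-component bilinear bound
  `Σ |α| c ω̂_{i₁}(a) ω̂_{i₂}(b) ≤ b·ω i k` (hypothesis `hB` of glue XVI-c / XIX-c / XIX-e) from the coefficient boxes of glue
  XXIV by an exact dyadic sum of magnitudes (helper for items stmt-NavierStokesRegularity-22987 `FlatGapCertificatesV2` (crux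
  K_A♭ of route TaoLadderRungTwoFlat) and stmt-24295 K_A₂(64); cell harvest/h2-tao-ladder, p1 g15; CHECKER-SPEC-v3 §3 (ii) C1)

On the window, `pwExt ω i n = ω i n`, so each term of the (B)-sum at target `(i,k)` equals `ω i k · |pcoef i k i₁ i₂ μ|` when both
factors are on the window and `0` otherwise; `|pcoef| ≤ mag (coefB …)` by `CoefBoxOK`. Hence `Σ_active mag(coefB) ≤ b`
(`checkB`, exact dyadic arithmetic, once per certificate) implies `hB` for every window component.

HONEST FRAMING: Tao-type MODEL lattices (Tao 2016 §4/§6 vocabulary, shift-set parametrised); arithmetic soundness lemma — no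
certificate data, nothing certified, no stub closed, nothing about the Navier–Stokes equations.
-/

-- the sub-problem namespace repeats the summit name by design (D-0017)
set_option linter.dupNamespace false

namespace Summit.NavierStokesRegularity.NavierStokesRegularity.Theorems

open Set Finset Literature.Analysis.FluidPDE Literature.Analysis.FluidPDE.TaoCascade
open Summit.NavierStokesRegularity.NavierStokesRegularity.Theorems.TaylorModelCert

namespace CertificateGlueOn

variable {m : ℕ} {Kb Ka : ℤ} {ω : Fin m → ℤ → ℝ} {ε₀ : ℝ} {α : Fin m → Fin m → Fin m → ℤ × ℤ × ℤ → ℝ}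
  {shifts : List (ℤ × ℤ × ℤ)} {coefB : Fin m → ℤ → Fin m → Fin m → ℤ × ℤ × ℤ → IntervalD}

/-- Magnitude of the coefficient box of an ACTIVE monomial (both factors on the window), `0` otherwise. [folklore] -/
def activeMag (Kb Ka : ℤ) (coefB : Fin m → ℤ → Fin m → Fin m → ℤ × ℤ × ℤ → IntervalD) (i : Fin m) (k : ℤ) (i₁ i₂ : Fin m)
    (μ : ℤ × ℤ × ℤ) : Dyad :=
  if (-Kb ≤ k - μ.2.2 + μ.1 ∧ k - μ.2.2 + μ.1 ≤ Ka) ∧ (-Kb ≤ k - μ.2.2 + μ.2.1 ∧ k - μ.2.2 + μ.2.1 ≤ Ka) then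
    IntervalD.mag (coefB i k i₁ i₂ μ) else Dyad.ofInt 0

/-- Exact dyadic sum of `activeMag` over `(i₁, i₂, μ) ∈ Fin m × Fin m × shifts` at target `(i, k)`. [folklore] -/
def bRowSum (Kb Ka : ℤ) (shifts : List (ℤ × ℤ × ℤ)) (coefB : Fin m → ℤ → Fin m → Fin m → ℤ × ℤ × ℤ → IntervalD)
    (i : Fin m) (k : ℤ) : Dyad :=
  (List.finRange m).foldr (fun i₁ acc₁ => Dyad.add ((List.finRange m).foldr (fun i₂ acc₂ => Dyad.add
    (shifts.foldr (fun μ acc₃ => Dyad.add (activeMag Kb Ka coefB i k i₁ i₂ μ) acc₃) (Dyad.ofInt 0)) acc₂) (Dyad.ofInt 0)) acc₁)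
    (Dyad.ofInt 0)

/-- **The (B)-table test**: `bRowSum ≤ b` at every window target `(i, k)`, `k = -Kb … Ka`. [folklore] -/
def checkB (m : ℕ) (Kb Ka : ℤ) (shifts : List (ℤ × ℤ × ℤ))
    (coefB : Fin m → ℤ → Fin m → Fin m → ℤ × ℤ × ℤ → IntervalD) (b : Dyad) : Bool :=
  (List.finRange m).all fun i => (List.range (winLen Kb Ka)).all fun c =>
    Dyad.ble (bRowSum Kb Ka shifts coefB i ((c : ℤ) - Kb)) b

/-- Value of a dyadic right fold of additions. [folklore] -/
theorem toReal_foldr_add {τ : Type*} (f : τ → Dyad) (l : List τ) :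
    (l.foldr (fun t acc => Dyad.add (f t) acc) (Dyad.ofInt 0)).toReal = (l.map fun t => (f t).toReal).sum := by
  induction l with
  | nil => simp
  | cons t l ih => simp [List.foldr_cons, ih]

/-- The value of `bRowSum` as a triple sum. [folklore] -/
theorem toReal_bRowSum (hnd : shifts.Nodup) (i : Fin m) (k : ℤ) :
    (bRowSum Kb Ka shifts coefB i k).toReal =
      ∑ i₁ : Fin m, ∑ i₂ : Fin m, ∑ μ ∈ shifts.toFinset, (activeMag Kb Ka coefB i k i₁ i₂ μ).toReal := by
  unfold bRowSum
  rw [toReal_foldr_add, Fin.sum_univ_def]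
  refine congrArg List.sum (List.map_congr_left fun i₁ _ => ?_)
  rw [toReal_foldr_add, Fin.sum_univ_def]
  refine congrArg List.sum (List.map_congr_left fun i₂ _ => ?_)
  rw [toReal_foldr_add, List.sum_toFinset _ hnd]

/-- One term of the (B)-sum is bounded by `ω i k · activeMag`. [folklore] -/
theorem bterm_le (hω : ∀ i k, 0 < ω i k) (hcoef : CoefBoxOK shifts ε₀ α Kb Ka ω coefB) (hε : 0 < 1 + ε₀)
    (i : Fin m) {k : ℤ} (hk1 : -Kb ≤ k) (hk2 : k ≤ Ka) (i₁ i₂ : Fin m) {μ : ℤ × ℤ × ℤ} (hμ : μ ∈ shifts) :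
    |α i₁ i₂ i μ| * (1 + ε₀) ^ ((5 : ℝ) * (k - μ.2.2) / 2) *
        (pwExt Kb Ka ω i₁ (k - μ.2.2 + μ.1) * pwExt Kb Ka ω i₂ (k - μ.2.2 + μ.2.1)) ≤
      ω i k * (activeMag Kb Ka coefB i k i₁ i₂ μ).toReal := by
  by_cases ha : -Kb ≤ k - μ.2.2 + μ.1 ∧ k - μ.2.2 + μ.1 ≤ Ka
  · by_cases hb : -Kb ≤ k - μ.2.2 + μ.2.1 ∧ k - μ.2.2 + μ.2.1 ≤ Ka
    · have hmag := IntervalD.abs_le_mag (hcoef i k i₁ i₂ μ hμ hk1 hk2)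
      have hc : 0 < (1 + ε₀) ^ ((5 : ℝ) * (k - μ.2.2) / 2) := Real.rpow_pos_of_pos hε _
      have hω0 : ω i k ≠ 0 := (hω i k).ne'
      have hval : |α i₁ i₂ i μ| * (1 + ε₀) ^ ((5 : ℝ) * (k - μ.2.2) / 2) *
          (ω i₁ (k - μ.2.2 + μ.1) * ω i₂ (k - μ.2.2 + μ.2.1)) = ω i k * |pcoef ε₀ α ω i k i₁ i₂ μ| := by
        unfold pcoef
        rw [abs_mul, abs_mul, abs_of_pos hc, abs_div, abs_of_pos (hω i k),
          abs_mul, abs_of_pos (hω i₁ _), abs_of_pos (hω i₂ _)]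
        field_simp
      simp only [pwExt, activeMag, if_pos ha, if_pos hb, if_pos (And.intro ha hb)]
      rw [hval]
      exact mul_le_mul_of_nonneg_left hmag (hω i k).le
    · simp [pwExt, activeMag, hb]
  · simp [pwExt, activeMag, ha]

/-- **`hB` FROM THE (B)-TABLE TEST**: `checkB = true` gives the per-component bilinear bound of glue XVI-c / XIX-c / XIX-e
for `𝕊 = shifts.toFinset`, `b := b.toReal`. [cite: Tao2016AveragedNS, §4 (4.8); cell certificate format, checker clauses] -/
theorem hB_of_checkB (hKb : 0 ≤ Kb) (hKa : 1 ≤ Ka) (hω : ∀ i k, 0 < ω i k) (hε : 0 < 1 + ε₀) (hnd : shifts.Nodup)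
    (hcoef : CoefBoxOK shifts ε₀ α Kb Ka ω coefB) {b : Dyad} (h : checkB m Kb Ka shifts coefB b = true) :
    ∀ i k, -Kb ≤ k → k ≤ Ka →
      ∑ i₁ : Fin m, ∑ i₂ : Fin m, ∑ μ ∈ shifts.toFinset,
        |α i₁ i₂ i μ| * (1 + ε₀) ^ ((5 : ℝ) * (k - μ.2.2) / 2) *
          (pwExt Kb Ka ω i₁ (k - μ.2.2 + μ.1) * pwExt Kb Ka ω i₂ (k - μ.2.2 + μ.2.1)) ≤ b.toReal * ω i k := by
  intro i k hk1 hk2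
  simp only [checkB, List.all_eq_true, List.mem_finRange, List.mem_range, Dyad.ble_iff, true_implies] at h
  have hc : (k + Kb).toNat < winLen Kb Ka := by
    unfold winLen; rw [Int.toNat_lt_toNat (by omega)]; omega
  have hrow := h i (k + Kb).toNat hc
  rw [Int.toNat_of_nonneg (by omega), show k + Kb - Kb = k by ring, toReal_bRowSum hnd] at hrow
  calc _ ≤ ∑ i₁ : Fin m, ∑ i₂ : Fin m, ∑ μ ∈ shifts.toFinset, ω i k * (activeMag Kb Ka coefB i k i₁ i₂ μ).toReal :=
        Finset.sum_le_sum fun i₁ _ => Finset.sum_le_sum fun i₂ _ => Finset.sum_le_sum fun μ hμ =>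
          bterm_le hω hcoef hε i hk1 hk2 i₁ i₂ (List.mem_toFinset.mp hμ)
    _ = ω i k * ∑ i₁ : Fin m, ∑ i₂ : Fin m, ∑ μ ∈ shifts.toFinset, (activeMag Kb Ka coefB i k i₁ i₂ μ).toReal := by
        simp only [Finset.mul_sum]
    _ ≤ ω i k * b.toReal := mul_le_mul_of_nonneg_left hrow (hω i k).le
    _ = b.toReal * ω i k := mul_comm _ _

end CertificateGlueOn

end Summit.NavierStokesRegularity.NavierStokesRegularity.Theorems
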